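import Literature.Computability.Complexity.KarpCliqueNP
import Literature.Computability.Complexity.KnapsackPartition
import HarnessLib

/-!
# `MAXCUT ∈ NP`: the weighted-graph-code test and the cut verifier in `P` (Karp 1972, Main Theorem, problem 21)

Membership half of the discharge of `Literature.Computability.Complexity.isNPComplete_MAXCUT`
(`KarpProblems.lean`; R. M. Karp, *Reducibility among combinatorial problems*, 1972, §4, Main
Theorem, problem 21: "MAX CUT. INPUT: graph `G`, weighting function `w : A → Z`, positive integer `W`.
PROPERTY: There is a set `S ⊆ N` such that `∑_{(u,v) ∈ A, u ∈ S, v ∉ S} w(u,v) ≥ W`."). Karp: "It is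
clear that these problems (or, more precisely, their encodings into `Σ*`), are all in NP" (§4), NP
being obtained from `P` "by polynomial-bounded existential quantification" (§3, Def. 4) — the tree's
`NP = polyExists P`. This file proves it for the tree's language
`MAXCUT = (encodingNatMatrix.pairBool encodingNatBool).toLanguage maxCutSet` at the machine level, in
the brick-assembly style and after the pattern of `KarpCliqueNP.lean` (`CLIQUE ∈ NP`), whose one-bit
tests `CliqueNP.wpF`, `CliqueNP.canT` and assembly lemma `CliqueNP.mem_P_of_oneBit` are reused, together
with the list-of-numerals canonicaliser `Knapsack.canonLFn` of `KnapsackPartition.lean`: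

* **The instance coding, field by field** (`instEnc_encode_eq`): the code of `(⟨n, w⟩, W)` is
  `⟨⟨encodeNat n, code of the row-major entry list entriesL n w⟩, encodeNat W⟩` (`n²` numerals).
* **The weighted-graph-code test** `codeT ∈ FP` (one bit): well paired twice, both numerals canonical,
  the matrix field a canonical list-of-numerals code (`Knapsack.isCanonLFn`) announcing exactly `n²`
  items (`cntT`: the binary length of its unary header against `n · n` by `prodFn`); `codeT_eq_true_iff`.
* **The cut verifier** `verifT ∈ FP` on `⟨x, y⟩`: the witness `y` is read as the characteristic vector
  of `S = {a | y[a] = 1}`; a counted fold (`Brick.foldLoop addFn cutPiece X`) over the flat index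
  `t < n²` adds the entry `t` (`HashBricks.nthItemFn`) whenever `y[t / n] ∧ ¬ y[t % n]`
  (`Plumb.divModFn`, `bitAtFn`), and the sum is compared with `W` (`Brick.ltFn`); its exact value on
  the code of ANY instance paired with ANY string is `verifT_encode` (`cutSumL = cutWeight`,
  `cutSumL_entriesL`).
* **Assembly** `MAXCUT_mem_NP`: `MAXCUT = codeLang ⊓ witnessLang` (`inter_P_mem_polyExists`).

## References

* R. M. Karp, *Reducibility among combinatorial problems*, in: R. E. Miller, J. W. Thatcher (eds.),
  Complexity of Computer Computations, Plenum 1972, 85–103: §3 Def. 4 (NP), §4, Main Theorem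
  (problem 21, MAX CUT) and the remark "these problems … are all in NP".
* S. Arora, B. Barak, *Computational Complexity: A Modern Approach*, CUP 2009, Def. 2.1 (`NP` by
  certificates), §0.1 (codes), §1.3 (closure of polynomial time under composition and bounded loops).
-/

noncomputable section

namespace Literature.Computability.Complexity

open _root_.Computability Brick OracleCompose Plumb HashBricks Polynomial Finset CliqueNP Knapsack

namespace MaxCutNP

/-! ### The instance coding, field by field -/

/-- The coding of `MAXCUT` instances `(⟨n, w⟩, W)`. [cite: Karp1972, §4 Main Theorem, problem 21] -/
abbrev instEnc : Encoding ((Σ n, Fin n → Fin n → ℕ) × ℕ) Bool := encodingNatMatrix.pairBool encodingNatBool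

/-- `MAXCUT` is the image of `maxCutSet` under `instEnc`. [folklore] -/
theorem MAXCUT_eq_image : MAXCUT = instEnc.encode '' maxCutSet := rfl

/-- The row-major entry list of a weight matrix: entry `t = i n + j` is `w i j`. [cite: AroraBarak2009, §0.1] -/
def entriesL (n : ℕ) (w : Fin n → Fin n → ℕ) : List ℕ :=
  List.ofFn fun k : Fin (n * n) => w (finProdFinEquiv.symm k).1 (finProdFinEquiv.symm k).2

/-- `n²` entries. [folklore] -/
@[simp] theorem length_entriesL (n : ℕ) (w : Fin n → Fin n → ℕ) : (entriesL n w).length = n * n := by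
  simp [entriesL]

/-- Reading an entry: `entries[t] = w (t / n) (t % n)`. [folklore] -/
theorem getD_entriesL {n : ℕ} (w : Fin n → Fin n → ℕ) {t : ℕ} (ht : t < n * n) :
    (entriesL n w).getD t 0 = w ⟨t / n, div_lt_of_lt_mul ht⟩ ⟨t % n, Nat.mod_lt _ (pos_of_lt_mul ht)⟩ := by
  rw [entriesL, List.getD_eq_getElem _ _ (by simpa using ht), List.getElem_ofFn]
  simp only [finProdFinEquiv_symm_apply, Fin.divNat, Fin.modNat]

/-- Reading the entry of a pair of vertices. [folklore] -/
theorem getD_entriesL_flat {n : ℕ} (w : Fin n → Fin n → ℕ) (i j : Fin n) :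
    (entriesL n w).getD (i * n + j) 0 = w i j := by
  rw [getD_entriesL w (flat_lt i j)]
  congr <;> simp [flat_div, Nat.mod_eq_of_lt j.isLt]

/-- **The code of an instance, field by field.** [cite: Karp1972, §4 Main Theorem, problem 21]
[cite: AroraBarak2009, §0.1] -/
theorem instEnc_encode_eq (n : ℕ) (w : Fin n → Fin n → ℕ) (W : ℕ) :
    instEnc.encode (⟨n, w⟩, W) = boolPair (boolPair (encodeNat n) (encodingListNatBool.encode (entriesL n w))) (encodeNat W) :=
  rfl

/-- `n` symbols fit in the code (indeed `n²` do). [folklore] -/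
theorem n_le_length_encode (n : ℕ) (w : Fin n → Fin n → ℕ) (W : ℕ) : n ≤ (instEnc.encode (⟨n, w⟩, W)).length := by
  rw [instEnc_encode_eq, length_boolPair, length_boolPair, encode_list_eq, length_boolPair, length_entriesL]
  have := List.length_replicate (n := n * n) (a := true)
  rw [show ones (n * n) = List.replicate (n * n) true from rfl, this]
  nlinarith

/-! ### Projections and the weighted-graph-code test -/

/-- The dimension numeral `nc` of an instance code `x = ⟨⟨nc, M⟩, Wc⟩`. [folklore] -/
def nF : List Bool → List Bool := fstF ∘ fstF
/-- The matrix field `M` (a list-of-numerals code) of `x = ⟨⟨nc, M⟩, Wc⟩`. [folklore] -/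
def mF : List Bool → List Bool := sndF ∘ fstF
/-- The target numeral `Wc` of `x = ⟨⟨nc, M⟩, Wc⟩`. [folklore] -/
def wF : List Bool → List Bool := sndF

/-- `nF ∈ FP`. [folklore] -/
theorem nF_mem_FP : nF ∈ FP := comp_mem_FP fstF_mem_FP fstF_mem_FP
/-- `mF ∈ FP`. [folklore] -/
theorem mF_mem_FP : mF ∈ FP := comp_mem_FP sndF_mem_FP fstF_mem_FP
/-- `wF ∈ FP`. [folklore] -/
theorem wF_mem_FP : wF ∈ FP := sndF_mem_FP

/-- The projections on the code of an instance. [folklore] -/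
theorem proj_encode (n : ℕ) (w : Fin n → Fin n → ℕ) (W : ℕ) :
    nF (instEnc.encode (⟨n, w⟩, W)) = encodeNat n ∧ mF (instEnc.encode (⟨n, w⟩, W)) = encodingListNatBool.encode (entriesL n w) ∧
      wF (instEnc.encode (⟨n, w⟩, W)) = encodeNat W := by
  rw [instEnc_encode_eq]; simp [nF, mF, wF]

/-- The dimension read off a string: `N = ⟦nc⟧`. [folklore] -/
def dimOf (x : List Bool) : ℕ := bitsToNat (nF x)

/-- **Item-count test** `cntT x = [|header of M| = N²]` (binary length of the unary header of the matrix
field against `N · N`). [folklore] -/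
def cntT : List Bool → List Bool := eqPairFn ∘ fanoutFn (lenBinF ∘ fstF ∘ mF) (prodFn ∘ fanoutFn nF nF)

/-- `cntT ∈ FP`. [cite: AroraBarakCC2009, §1.3] -/
theorem cntT_mem_FP : cntT ∈ FP :=
  comp_mem_FP eqPairFn_mem_FP (fanoutFn_mem_FP (comp_mem_FP lenBinF_mem_FP (comp_mem_FP fstF_mem_FP mF_mem_FP))
    (comp_mem_FP prodFn_mem_FP (fanoutFn_mem_FP nF_mem_FP nF_mem_FP)))

/-- Value of `cntT`. [folklore] -/
theorem cntT_apply (x : List Bool) : cntT x = [decide ((fstF (mF x)).length = dimOf x * dimOf x)] := by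
  simp only [cntT, dimOf, Function.comp_apply, fanoutFn_apply, eqPairFn_boolPair, lenBinF_apply, prodFn_boolPair]
  congr 1
  apply Bool.decide_congr
  exact ⟨fun h => by simpa using congrArg decodeNat h, fun h => by rw [h]⟩

/-- **The weighted-graph-code test**: well paired twice, canonical numerals, the matrix field a canonical
list-of-numerals code with `N²` items. [cite: AroraBarak2009, §0.1] -/
def codeT : List Bool → List Bool :=
  andFn wpF (andFn (wpF ∘ fstF) (andFn (canT ∘ nF) (andFn (canT ∘ wF) (andFn (isCanonLFn ∘ mF) cntT))))

/-- **`codeT ∈ FP`.** [cite: AroraBarakCC2009, §1.3] -/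
theorem codeT_mem_FP : codeT ∈ FP :=
  andFn_mem_FP wpF_mem_FP (andFn_mem_FP (comp_mem_FP wpF_mem_FP fstF_mem_FP)
    (andFn_mem_FP (comp_mem_FP canT_mem_FP nF_mem_FP) (andFn_mem_FP (comp_mem_FP canT_mem_FP wF_mem_FP)
      (andFn_mem_FP (comp_mem_FP isCanonLFn_mem_FP mF_mem_FP) cntT_mem_FP))))

/-- The proposition decided by `codeT`. [folklore] -/
def CodeOK (x : List Bool) : Prop :=
  boolPair (fstF x) (sndF x) = x ∧ boolPair (nF x) (mF x) = fstF x ∧ canonF (nF x) = nF x ∧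
    canonF (wF x) = wF x ∧ encodingListNatBool.encode (decNatList (mF x)) = mF x ∧
      (fstF (mF x)).length = dimOf x * dimOf x

/-- `CodeOK` is decidable. [folklore] -/
instance CodeOK.decidable : DecidablePred CodeOK := fun x => by
  unfold CodeOK; infer_instance

/-- **Value of the weighted-graph-code test.** [folklore] -/
theorem codeT_apply (x : List Bool) : codeT x = [decide (CodeOK x)] := by
  have h : codeT x = [decide (boolPair (fstF x) (sndF x) = x ∧ (boolPair (fstF (fstF x)) (sndF (fstF x)) = fstF x ∧
      (canonF (nF x) = nF x ∧ (canonF (wF x) = wF x ∧ (encodingListNatBool.encode (decNatList (mF x)) = mF x ∧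
        (fstF (mF x)).length = dimOf x * dimOf x)))))] :=
    andFn_decide (wpF_apply x) (andFn_decide (by rw [Function.comp_apply, wpF_apply])
      (andFn_decide (by rw [Function.comp_apply, canT_apply]) (andFn_decide (by rw [Function.comp_apply, canT_apply])
        (andFn_decide (by rw [Function.comp_apply, isCanonLFn_apply]) (cntT_apply x)))))
  rw [h]; rfl

/-- `codeT` is one-bit. [folklore] -/
theorem oneBit_codeT : OneBit codeT := fun x => ⟨_, codeT_apply x⟩

/-- **The test accepts the code of every instance.** [folklore] -/
theorem codeOK_encode (n : ℕ) (w : Fin n → Fin n → ℕ) (W : ℕ) : CodeOK (instEnc.encode (⟨n, w⟩, W)) := by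
  obtain ⟨hnc, hm, hwc⟩ := proj_encode n w W
  have hdim : dimOf (instEnc.encode (⟨n, w⟩, W)) = n := by rw [dimOf, hnc, bitsToNat_encodeNat]
  refine ⟨?_, ?_, ?_, ?_, ?_, ?_⟩
  · rw [instEnc_encode_eq]; simp
  · rw [hnc, hm, instEnc_encode_eq]; simp
  · rw [hnc, canonF_encodeNat]
  · rw [hwc, canonF_encodeNat]
  · rw [hm, decNatList_encode]
  · rw [hm, hdim, encode_list_eq, fstF_boolPair, length_entriesL]; exact List.length_replicate ..

/-- `List.ofFn` of `getD` over the full index range gives back the list. [folklore] -/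
theorem ofFn_getD_nat {m : ℕ} {l : List ℕ} (hl : l.length = m) : (List.ofFn fun k : Fin m => l.getD k 0) = l := by
  subst hl
  refine List.ext_getElem (by simp) fun i h1 h2 => ?_
  rw [List.getElem_ofFn, List.getD_eq_getElem _ _ h2]

/-- **A string passing the test is the code of an instance** (the matrix read back from the row-major
entry list). [folklore] -/
theorem exists_eq_encode_of_codeOK {x : List Bool} (h : CodeOK x) :
    ∃ (n : ℕ) (w : Fin n → Fin n → ℕ) (W : ℕ), x = instEnc.encode (⟨n, w⟩, W) := by
  obtain ⟨hwp, hwp', hnc, hwc, hm, hcnt⟩ := h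
  set n := decodeNat (nF x) with hn
  have hnc' : nF x = encodeNat n := by rw [← hnc, canonF_eq_encodeNat_decodeNat]
  have hdim : dimOf x = n := by rw [dimOf, hnc', bitsToNat_encodeNat]
  set l := decNatList (mF x) with hl
  have hlen : l.length = n * n := by
    have e : fstF (mF x) = ones l.length := by rw [← hm, encode_list_eq, fstF_boolPair]
    rw [← hdim, ← hcnt, e]; exact (List.length_replicate ..).symm
  set w : Fin n → Fin n → ℕ := fun i j => l.getD (i * n + j) 0 with hwdef
  have hent : entriesL n w = l := by
    have e : entriesL n w = List.ofFn fun k : Fin (n * n) => l.getD k 0 := by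
      refine List.ext_getElem (by simp) fun t h1 h2 => ?_
      have ht : t < n * n := by simpa using h1
      have e1 := getD_entriesL w ht
      rw [List.getD_eq_getElem _ _ h1] at e1
      rw [e1, List.getElem_ofFn]
      change l.getD (t / n * n + t % n) 0 = _
      rw [Nat.div_add_mod' t n]
    rw [e, ofFn_getD_nat hlen]
  set W := decodeNat (wF x) with hW
  have hwc' : wF x = encodeNat W := by rw [← hwc, canonF_eq_encodeNat_decodeNat]
  refine ⟨n, w, W, ?_⟩
  calc x = boolPair (fstF x) (sndF x) := hwp.symm
    _ = boolPair (boolPair (nF x) (mF x)) (wF x) := by rw [hwp']; rfl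
    _ = instEnc.encode (⟨n, w⟩, W) := by rw [instEnc_encode_eq, ← hnc', ← hwc', hent, hm]

/-- **`codeT x = [1]` iff `x` is the code of an instance.** [cite: AroraBarak2009, §0.1] -/
theorem codeT_eq_true_iff (x : List Bool) :
    codeT x = [true] ↔ ∃ (n : ℕ) (w : Fin n → Fin n → ℕ) (W : ℕ), x = instEnc.encode (⟨n, w⟩, W) := by
  rw [codeT_apply]
  simp only [List.cons.injEq, and_true, decide_eq_true_eq]
  exact ⟨exists_eq_encode_of_codeOK, fun ⟨n, w, W, hx⟩ => hx ▸ codeOK_encode n w W⟩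

/-- **The language of weighted-graph-instance codes.** [cite: Karp1972, §4 Main Theorem, problem 21] -/
def codeLang : Language Bool := {x | codeT x = [true]}

/-- **`codeLang ∈ P`.** [cite: AroraBarakCC2009, Def. 1.13 and §1.3] -/
theorem codeLang_mem_P : codeLang ∈ Classes.P := mem_P_of_oneBit codeT_mem_FP oneBit_codeT

/-- Membership in `codeLang`. [folklore] -/
theorem mem_codeLang_iff (x : List Bool) :
    x ∈ codeLang ↔ ∃ (n : ℕ) (w : Fin n → Fin n → ℕ) (W : ℕ), x = instEnc.encode (⟨n, w⟩, W) :=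
  codeT_eq_true_iff x

/-! ### The cut verifier: `W ≤ ∑_{t < n²} [y[t/n] ∧ ¬ y[t%n]] · entry t` -/

/-- The cut sum read off an entry list `l` and a witness `y` (characteristic vector of `S`): the entries
`t = i n + j` with `y[i] ∧ ¬ y[j]`. [cite: Karp1972, §4 Main Theorem, problem 21] -/
def cutSumL (n : ℕ) (l : List ℕ) (y : List Bool) : ℕ :=
  ∑ t ∈ Finset.range (n * n), if y.getD (t / n) false = true ∧ y.getD (t % n) false = false then l.getD t 0 else 0

/-- The vertex set selected by a witness. [folklore] -/
def setOf (n : ℕ) (y : List Bool) : Finset (Fin n) := univ.filter fun a => y.getD a false = true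

/-- **The cut sum of the entry list is the tree's cut weight of the selected vertex set.**
[cite: Karp1972, §4 Main Theorem, problem 21] -/
theorem cutSumL_entriesL (n : ℕ) (w : Fin n → Fin n → ℕ) (y : List Bool) :
    cutSumL n (entriesL n w) y = cutWeight w (setOf n y) := by
  have h1 : cutWeight w (setOf n y) =
      ∑ a : Fin n, ∑ b : Fin n, if y.getD (a : ℕ) false = true ∧ y.getD (b : ℕ) false = false then w a b else 0 := by
    unfold cutWeight
    have ho : ∑ a ∈ setOf n y, ∑ b ∈ (setOf n y)ᶜ, w a b = ∑ a, if a ∈ setOf n y then ∑ b ∈ (setOf n y)ᶜ, w a b else 0 := by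
      rw [Finset.sum_ite_mem, Finset.univ_inter]
    rw [ho]
    refine Finset.sum_congr rfl fun a _ => ?_
    have hi : ∑ b ∈ (setOf n y)ᶜ, w a b = ∑ b, if b ∈ (setOf n y)ᶜ then w a b else 0 := by
      rw [Finset.sum_ite_mem, Finset.univ_inter]
    rw [hi]
    by_cases ha : y.getD a false = true
    · have ha' : a ∈ setOf n y := Finset.mem_filter.2 ⟨Finset.mem_univ _, ha⟩
      rw [if_pos ha']
      refine Finset.sum_congr rfl fun b _ => ?_
      by_cases hb : y.getD b false = true
      · have hb' : b ∉ (setOf n y)ᶜ := by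
          rw [Finset.mem_compl, not_not]; exact Finset.mem_filter.2 ⟨Finset.mem_univ _, hb⟩
        rw [if_neg hb', if_neg (fun h => absurd h.2 (by rw [hb]; decide))]
      · have hb' : b ∈ (setOf n y)ᶜ := Finset.mem_compl.2 fun h => hb (Finset.mem_filter.1 h).2
        rw [if_pos hb', if_pos ⟨ha, eq_false_of_ne_true hb⟩]
    · have ha' : a ∉ setOf n y := fun h => ha (Finset.mem_filter.1 h).2
      rw [if_neg ha']
      symm
      refine Finset.sum_eq_zero fun b _ => ?_
      rw [if_neg (fun h => ha h.1)]
  rw [h1, ← Fintype.sum_prod_type', ← Equiv.sum_comp finProdFinEquiv.symm, cutSumL, ← Fin.sum_univ_eq_sum_range]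
  refine Finset.sum_congr rfl fun k _ => ?_
  rw [getD_entriesL w k.isLt]
  simp only [finProdFinEquiv_symm_apply, Fin.divNat, Fin.modNat]

variable {n : ℕ} {wm : Fin n → Fin n → ℕ} {W : ℕ} {y : List Bool}

/-- On `⟨z, 1ᵗ⟩` with `z = ⟨x, y⟩`: the instance `x`. [folklore] -/
def pX : List Bool → List Bool := fstF ∘ fstF
/-- On `⟨z, 1ᵗ⟩`: the witness `y`. [folklore] -/
def pY : List Bool → List Bool := sndF ∘ fstF
/-- On `⟨z, 1ᵗ⟩`: the unary dimension `1^{min N |z|}` (`binToUnaryFn` against the ruler `z`). [folklore] -/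
def pN : List Bool → List Bool := binToUnaryFn ∘ fanoutFn fstF (nF ∘ pX)
/-- On `⟨z, 1ᵗ⟩`: `⟨1^{t / N}, 1^{t % N}⟩`. [folklore] -/
def pIJ : List Bool → List Bool := divModFn ∘ fanoutFn pN sndF
/-- On `⟨z, 1ᵗ⟩`: the bit `[y[t / N]]` (default `0` past the end of `y`). [folklore] -/
def pYI : List Bool → List Bool := headBitFn ∘ bitAtFn ∘ fanoutFn (fstF ∘ pIJ) pY
/-- On `⟨z, 1ᵗ⟩`: the bit `[y[t % N]]`. [folklore] -/
def pYJ : List Bool → List Bool := headBitFn ∘ bitAtFn ∘ fanoutFn (sndF ∘ pIJ) pY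
/-- On `⟨z, 1ᵗ⟩`: the numeral of entry `t` (item `t` of the matrix field). [folklore] -/
def pItem : List Bool → List Bool := nthItemFn ∘ fanoutFn sndF (sndF ∘ mF ∘ pX)

/-- **The cut piece** at the flat index `t = i N + j`: entry `t` if `y[i] ∧ ¬ y[j]`, else `ε`.
[cite: Karp1972, §4 Main Theorem, problem 21] -/
def cutPiece : List Bool → List Bool := iteFn (andFn pYI (notFn pYJ)) pItem fun _ => []

/-- `pN ∈ FP`. [folklore] -/
theorem pN_mem_FP : pN ∈ FP :=
  comp_mem_FP binToUnaryFn_mem_FP (fanoutFn_mem_FP fstF_mem_FP (comp_mem_FP nF_mem_FP (comp_mem_FP fstF_mem_FP fstF_mem_FP)))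
/-- `pIJ ∈ FP`. [folklore] -/
theorem pIJ_mem_FP : pIJ ∈ FP := comp_mem_FP divModFn_mem_FP (fanoutFn_mem_FP pN_mem_FP sndF_mem_FP)
/-- `pYI ∈ FP`. [folklore] -/
theorem pYI_mem_FP : pYI ∈ FP :=
  comp_mem_FP headBitFn_mem_FP (comp_mem_FP bitAtFn_mem_FP (fanoutFn_mem_FP (comp_mem_FP fstF_mem_FP pIJ_mem_FP)
    (comp_mem_FP sndF_mem_FP fstF_mem_FP)))
/-- `pYJ ∈ FP`. [folklore] -/
theorem pYJ_mem_FP : pYJ ∈ FP :=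
  comp_mem_FP headBitFn_mem_FP (comp_mem_FP bitAtFn_mem_FP (fanoutFn_mem_FP (comp_mem_FP sndF_mem_FP pIJ_mem_FP)
    (comp_mem_FP sndF_mem_FP fstF_mem_FP)))
/-- `pItem ∈ FP`. [folklore] -/
theorem pItem_mem_FP : pItem ∈ FP :=
  comp_mem_FP nthItemFn_mem_FP (fanoutFn_mem_FP sndF_mem_FP (comp_mem_FP sndF_mem_FP (comp_mem_FP mF_mem_FP
    (comp_mem_FP fstF_mem_FP fstF_mem_FP))))
/-- `cutPiece ∈ FP`. [cite: AroraBarakCC2009, §1.3] -/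
theorem cutPiece_mem_FP : cutPiece ∈ FP :=
  iteFn_mem_FP (andFn_mem_FP pYI_mem_FP (notFn_mem_FP pYJ_mem_FP)) pItem_mem_FP (const_mem_FP _)

/-- `pYI` is one-bit. [folklore] -/
theorem oneBit_pYI : OneBit pYI := oneBit_headBitFn.comp _
/-- `pYJ` is one-bit. [folklore] -/
theorem oneBit_pYJ : OneBit pYJ := oneBit_headBitFn.comp _

/-- The item read is a substring of the first field: `|pItem p| ≤ |fstF p|`. [folklore] -/
theorem length_pItem_le (p : List Bool) : (pItem p).length ≤ (fstF p).length := by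
  simp only [pItem, mF, pX, Function.comp_apply, fanoutFn_apply, nthItemFn_boolPair]
  have h1 := length_fstF_sndF_le (sndF^[(sndF p).length] (sndF (sndF (fstF (fstF (fstF p))))))
  have h2 := Ladder3.length_iterate_sndF_le (sndF p).length (sndF (sndF (fstF (fstF (fstF p)))))
  have h3 := length_fstF_sndF_le (sndF (fstF (fstF (fstF p))))
  have h4 := length_fstF_sndF_le (fstF (fstF (fstF p)))
  have h5 := length_fstF_sndF_le (fstF (fstF p))
  have h6 := length_fstF_sndF_le (fstF p)
  omega

/-- **Linear total bound for the cut piece** (so the fold needs no clipping). [folklore] -/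
theorem length_cutPiece_le (p : List Bool) : (cutPiece p).length ≤ 1 * ((fstF p).length + 1) := by
  rw [cutPiece, iteFn_of_oneBit (oneBit_andFn oneBit_pYI (oneBit_notFn oneBit_pYJ))]
  split_ifs
  · have := length_pItem_le p; omega
  · simp

/-- The initial record of the sum fold on `z = ⟨x, y⟩`: `⟨z, ⟨⌜|header of M|⌝, ⟨1⁰, ε⟩⟩⟩`. [folklore] -/
def sInit : List Bool → List Bool :=
  fanoutFn (fun z => z) (fanoutFn (lenBinF ∘ fstF ∘ mF ∘ fstF) (fun _ => boolPair [] []))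

/-- `sInit ∈ FP`. [folklore] -/
theorem sInit_mem_FP : sInit ∈ FP :=
  fanoutFn_mem_FP (PolyTimeComputable.id _) (fanoutFn_mem_FP
    (comp_mem_FP lenBinF_mem_FP (comp_mem_FP fstF_mem_FP (comp_mem_FP mF_mem_FP fstF_mem_FP))) (const_mem_FP _))

/-- Value of `sInit`. [folklore] -/
theorem sInit_apply (z : List Bool) :
    sInit z = boolPair z (boolPair (encodeNat (fstF (mF (fstF z))).length) (boolPair (ones 0) [])) := by
  simp [sInit, ones]

/-- The round count never exceeds the rounds available. [folklore] -/
theorem rounds_le (z : List Bool) : (fstF (mF (fstF z))).length ≤ (X : Polynomial ℕ).eval z.length := by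
  rw [eval_X]
  simp only [mF, Function.comp_apply]
  have h1 := length_fstF_sndF_le (sndF (fstF (fstF z)))
  have h2 := length_fstF_sndF_le (fstF (fstF z))
  have h3 := length_fstF_sndF_le (fstF z)
  have h4 := length_fstF_sndF_le z
  omega

/-- **The cut-sum fold**: `Brick.foldLoop addFn cutPiece X` from `sInit`. [cite: AroraBarakCC2009, §1.3] -/
def sumT : List Bool → List Bool := sndPow 2 ∘ foldLoop addFn cutPiece X ∘ sInit

/-- `sumT ∈ FP`. [cite: AroraBarakCC2009, §1.3] -/
theorem sumT_mem_FP : sumT ∈ FP :=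
  comp_mem_FP (sndPow_mem_FP 2) (comp_mem_FP (foldLoop_mem_FP addFn_mem_FP length_addFn_le cutPiece_mem_FP length_cutPiece_le X)
    sInit_mem_FP)

/-- **Value of the cut-sum fold on every input.** [folklore] -/
theorem sumT_apply (z : List Bool) :
    sumT z = encodeNat (∑ t ∈ Finset.range (fstF (mF (fstF z))).length, bitsToNat (cutPiece (boolPair z (ones t)))) := by
  rw [sumT, Function.comp_apply, Function.comp_apply, sInit_apply, foldLoop_apply _ _ (rounds_le z),
    show ([] : List Bool) = encodeNat 0 from rfl, foldAcc_addFn]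
  simp only [sndPow_succ_boolPair, sndPow_zero_boolPair, Nat.zero_add]

/-- **The cut verifier** `verifT ⟨x, y⟩ = [¬ (cut sum < W)]`. [cite: Karp1972, §4 Main Theorem, problem 21] -/
def verifT : List Bool → List Bool := notFn (ltFn ∘ fanoutFn sumT (wF ∘ fstF))

/-- `verifT ∈ FP`. [cite: AroraBarakCC2009, §1.3] -/
theorem verifT_mem_FP : verifT ∈ FP :=
  notFn_mem_FP (comp_mem_FP ltFn_mem_FP (fanoutFn_mem_FP sumT_mem_FP (comp_mem_FP wF_mem_FP fstF_mem_FP)))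

/-- `verifT` is one-bit. [folklore] -/
theorem oneBit_verifT : OneBit verifT := oneBit_notFn (oneBit_ltFn.comp _)

/-- **The verifier language.** [cite: Karp1972, §3 Def. 4] -/
def verifLang : Language Bool := {w | verifT w = [true]}

/-- **`verifLang ∈ P`.** [cite: AroraBarakCC2009, Def. 1.13 and §1.3] -/
theorem verifLang_mem_P : verifLang ∈ Classes.P := mem_P_of_oneBit verifT_mem_FP oneBit_verifT

/-! ### The value of the verifier on the code of an instance paired with any string -/

section Encode

variable (n : ℕ) (w : Fin n → Fin n → ℕ) (W : ℕ) (y : List Bool)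

/-- The dimension fits in the ruler `z = ⟨x, y⟩`. [folklore] -/
theorem n_le_length_pair : n ≤ (boolPair (instEnc.encode (⟨n, w⟩, W)) y).length := by
  have := n_le_length_encode n w W
  rw [length_boolPair]; omega

/-- Items of a list code by iterated second projections (twin of `OneInThreeMaxCut.fstF_iterate_sndF_encList`
in `MaxCutGadgetMachine.lean`, a sibling not imported here). [folklore] -/
theorem fstF_iterate_sndF_encList' (L : List (List Bool)) :
    ∀ (t : ℕ) (ht : t < L.length), fstF (sndF^[t] (encList L)) = L[t] := by
  induction L with
  | nil => intro t ht; simp at ht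
  | cons a L ih =>
    intro t ht
    cases t with
    | zero => simp [encList_cons]
    | succ t =>
      rw [Function.iterate_succ_apply, encList_cons, sndF_boolPair, List.getElem_cons_succ]
      exact ih t (by simpa using ht)

/-- **Value of the cut piece** at a flat index `t < n²` on the code of an instance. [folklore] -/
theorem bitsToNat_cutPiece_encode {t : ℕ} (ht : t < n * n) :
    bitsToNat (cutPiece (boolPair (boolPair (instEnc.encode (⟨n, w⟩, W)) y) (ones t))) =
      (if y.getD (t / n) false = true ∧ y.getD (t % n) false = false then (entriesL n w).getD t 0 else 0) := by
  obtain ⟨hnc, hm, -⟩ := proj_encode n w W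
  set z := boolPair (instEnc.encode (⟨n, w⟩, W)) y with hz
  have hX : pX (boolPair z (ones t)) = instEnc.encode (⟨n, w⟩, W) := by simp [pX, hz]
  have hYv : pY (boolPair z (ones t)) = y := by simp [pY, hz]
  have hN : pN (boolPair z (ones t)) = ones n := by
    rw [pN, Function.comp_apply, fanoutFn_apply, fstF_boolPair, Function.comp_apply, hX, hnc, binToUnaryFn_boolPair,
      bitsToNat_encodeNat, min_eq_left (n_le_length_pair n w W y)]
  have hIJ : pIJ (boolPair z (ones t)) = boolPair (ones (t / n)) (ones (t % n)) := by
    rw [pIJ, Function.comp_apply, fanoutFn_apply, hN, sndF_boolPair, divModFn_boolPair]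
  have hI : pYI (boolPair z (ones t)) = [y.getD (t / n) false] := by
    rw [pYI, Function.comp_apply, Function.comp_apply, fanoutFn_apply, Function.comp_apply, hIJ, fstF_boolPair, hYv,
      bitAtFn_boolPair, headBitFn_apply, List.length_replicate, headD_take_one_drop]
  have hJ : pYJ (boolPair z (ones t)) = [y.getD (t % n) false] := by
    rw [pYJ, Function.comp_apply, Function.comp_apply, fanoutFn_apply, Function.comp_apply, hIJ, sndF_boolPair, hYv,
      bitAtFn_boolPair, headBitFn_apply, List.length_replicate, headD_take_one_drop]
  have hItem : pItem (boolPair z (ones t)) = encodeNat ((entriesL n w).getD t 0) := by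
    rw [pItem, Function.comp_apply, fanoutFn_apply, sndF_boolPair, Function.comp_apply, Function.comp_apply, hX, hm,
      encode_list_eq, sndF_boolPair, nthItemFn_boolPair, List.length_replicate,
      fstF_iterate_sndF_encList' _ t (by simpa using ht), List.getElem_map,
      List.getD_eq_getElem _ _ (by simpa using ht)]
  rw [cutPiece, iteFn_apply (andFn_apply hI (notFn_apply hJ))]
  cases hi : y.getD (t / n) false <;> cases hj : y.getD (t % n) false <;> simp [hItem]

/-- **Value of the cut-sum fold** on the code of an instance paired with any string: the cut sum.
[folklore] -/
theorem sumT_encode : sumT (boolPair (instEnc.encode (⟨n, w⟩, W)) y) = encodeNat (cutSumL n (entriesL n w) y) := by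
  obtain ⟨-, hm, -⟩ := proj_encode n w W
  have hk : (fstF (mF (fstF (boolPair (instEnc.encode (⟨n, w⟩, W)) y)))).length = n * n := by
    rw [fstF_boolPair, hm, encode_list_eq, fstF_boolPair, length_entriesL]; exact List.length_replicate ..
  rw [sumT_apply, hk, cutSumL]
  exact congrArg encodeNat (Finset.sum_congr rfl fun t ht => bitsToNat_cutPiece_encode n w W y (Finset.mem_range.1 ht))

/-- **Value of the verifier on the code of ANY instance paired with ANY string**: `[W ≤ cut weight of
the selected set]`. [cite: Karp1972, §4 Main Theorem, problem 21] -/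
theorem verifT_encode :
    verifT (boolPair (instEnc.encode (⟨n, w⟩, W)) y) = [decide (W ≤ cutWeight w (setOf n y))] := by
  obtain ⟨-, -, hwc⟩ := proj_encode n w W
  rw [verifT, notFn_apply (c := ltFn ∘ fanoutFn sumT (wF ∘ fstF))
    (b := decide (cutSumL n (entriesL n w) y < W)) (by
      rw [Function.comp_apply, fanoutFn_apply, sumT_encode, Function.comp_apply, fstF_boolPair, hwc, ltFn_boolPair,
        bitsToNat_encodeNat, bitsToNat_encodeNat]),
    cutSumL_entriesL]
  congr 1
  rw [← decide_not]
  exact decide_eq_decide.2 not_lt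

end Encode

/-! ### `MAXCUT ∈ NP` -/

/-- **The certificate form of the cut question over `codeLang`** (witness length `≤ |x|`).
[cite: Karp1972, §3 Def. 4] [cite: AroraBarakCC2009, Def. 2.1] -/
def witnessLang : Language Bool :=
  {x | ∃ y : List Bool, y.length ≤ (X : Polynomial ℕ).eval x.length ∧ boolPair x y ∈ verifLang}

/-- `witnessLang ∈ NP`. [cite: AroraBarakCC2009, Def. 2.1] -/
theorem witnessLang_mem_NP : witnessLang ∈ Nondeterministic.NP :=
  ⟨verifLang, verifLang_mem_P, X, fun _ => Iff.rfl⟩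

/-- The set selected by the characteristic vector of `S` is `S`. [folklore] -/
theorem setOf_ofFn {n : ℕ} (S : Finset (Fin n)) : setOf n (List.ofFn fun a : Fin n => decide (a ∈ S)) = S := by
  ext a; simp [setOf]

/-- **`MAXCUT` is the intersection of the code language with the certificate language**: a set `S` with
`W ≤ cutWeight w S` gives the witness `List.ofFn (· ∈ S)` (length `n ≤ |x|`); an accepted witness selects
a set of the required cut weight. [cite: Karp1972, §4 Main Theorem, problem 21] [cite: AroraBarakCC2009, Def. 2.1] -/
theorem MAXCUT_eq_inter : MAXCUT = codeLang ⊓ witnessLang := by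
  ext x
  constructor
  · rintro ⟨⟨⟨n, w⟩, W⟩, hmem, rfl⟩
    obtain ⟨S, hS⟩ : ∃ S : Finset (Fin n), W ≤ cutWeight w S := hmem
    refine ⟨(mem_codeLang_iff _).2 ⟨n, w, W, rfl⟩, List.ofFn (fun a : Fin n => decide (a ∈ S)), ?_, ?_⟩
    · rw [eval_X, List.length_ofFn]
      exact n_le_length_encode n w W
    · change verifT _ = [true]
      rw [verifT_encode, setOf_ofFn, decide_eq_true hS]
  · rintro ⟨hcode, y, -, hacc⟩
    obtain ⟨n, w, W, rfl⟩ := (mem_codeLang_iff x).1 hcode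
    change verifT _ = [true] at hacc
    rw [verifT_encode] at hacc
    have hW : W ≤ cutWeight w (setOf n y) := of_decide_eq_true (List.cons.inj hacc).1
    exact ⟨(⟨n, w⟩, W), ⟨setOf n y, hW⟩, rfl⟩

/-- **`MAXCUT ∈ NP`**: an intersection of a `P` language (the codes) with a language given by a
polynomial-time verifier (`inter_P_mem_polyExists`). [cite: Karp1972, §4 Main Theorem, problem 21]
[cite: AroraBarakCC2009, Def. 2.1] -/
theorem MAXCUT_mem_NP : MAXCUT ∈ Nondeterministic.NP := by
  rw [MAXCUT_eq_inter]
  exact inter_P_mem_polyExists (K := Classes.P) (fun _ _ a b => inter_mem_P a b) codeLang_mem_P witnessLang_mem_NP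

end MaxCutNP

/-- **`MAXCUT ∈ NP`** (Karp 1972, §4: the problems of the Main Theorem "are all in NP"; here problem 21,
weighted MAX CUT, for the tree's `MAXCUT = (encodingNatMatrix.pairBool encodingNatBool).toLanguage maxCutSet`).
[cite: Karp1972, §4 Main Theorem, problem 21] -/
theorem MAXCUT_mem_NP : MAXCUT ∈ Nondeterministic.NP := MaxCutNP.MAXCUT_mem_NP

end Literature.Computability.Complexity

end
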